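import Literature.IUT.HodgeArakelov.GMonoidFrobenioidsGaussian
import HarnessLib

/-!
# [IUTchII] Definition 3.8 / Corollary 3.7 (i) «compatible collections of isomorphisms» at the Frobenioid level:
# the functor of model Frobenioids of a `G`-monoid is FUNCTORIAL in equivariant maps — composites, squares, chains

S. Mochizuki, *Inter-universal Teichmüller theory II*, §3, kurims manuscript (Dec. 2020): Corollary 3.7 (i) p. 111
l. 21 – p. 112 l. 6 «induces compatible [in the evident sense] collections of isomorphisms …
`Ψ^ι_env(M^Θ_*(Π_v)) ⥲ Ψ_ξ(M^Θ_*(Π_v))` … `⥲ Ψ_ξ(M^Θ_*(†F_v)) ⥲ Ψ_{F_ξ}(†F_v)`»; Definition 3.8 (ii) p. 114 l. 44–52 «the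
isomorphisms of monoids in the bottom line of the third display of Corollary 3.6, (ii), may be interpreted as isomorphisms
of split Frobenioids `F_{†F^Θ_v,α} ⥲ F^ι_env(M^Θ_*) ⥲ F_ξ(M^Θ_*) ⥲ F_{F_ξ}(†F_v)` … which are compatible …»; Remark 3.8.1 p. 115
«an "isomorphism of categories" is to be understood as an isomorphism class of equivalences of categories … the simplest
approach is to resort to the original monoid-theoretic formulations» [cite: Mochizuki2012, Cor 3.7 (i) p.111].
[FrdI] Prop. 5.3 p. 103 («the functors that arise naturally from the construction») [cite: MochizukiFrdI2008, Prop. 5.3 p.103].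
Claim key DISPUTED (D-0012): nothing of [IUTchII] is asserted.

abc-iut cell, layer L6, MERGE-MAP row **R-Def38-a**, item «COR37i-FRD-SQUARES (a)» (SAME-GROUP form: the acting groups
already identified, all functors over `𝟭` of `𝓑(G)⁰`; form (b) over re-factorized base changes is NOT here — it needs a
composition isomorphism for abc-iut-L5-t2's `CosetCat.pull`), seat abc-iut-L6-t7 gen 6.  PROOF-ONLY (0 `def`/`structure`/
`instance`, no new `Prop` fact) over abc-iut-L6-t7's `CoveringMonoid.frobenioidMap φ hφ` (p457393: the functor of model
Frobenioids `F(G ↷ Ψ) ⥤ F(G ↷ Ψ')` of a `G`-equivariant `φ : Ψ → Ψ'`, `(G/U, α) ↦ (G/U, η^gp α)`), abc-iut-L1's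
`ModelFrobenioid.hom_ext`, `MonGp.map_id / map_comp`, `associatesMap_mk`.

WHAT IS PROVED.
* §1 `modelFrobenioid_hom_heq` — a morphism of a model Frobenioid is determined, up to `HEq` along equal endpoints, by
  `(deg_Fr, Base, Div, u)` (bookkeeping for `Functor.hext`).
* §2 **FUNCTORIALITY of `frobenioidMap`**: `frobenioidMap_congr` (equal maps ⇒ equal functors), `frobenioidMap_id`
  (`F(id) = 𝟭`), **`frobenioidMap_comp`** (`F(φ) ⋙ F(ψ) = F(ψ ∘ φ)` — the objects `(G/U, η_ψ^gp (η_φ^gp α))` and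
  `(G/U, η_{ψφ}^gp α)` agree by `MonGp.map_comp`, the morphisms componentwise).
* §3 **«compatible [in the evident sense]»**: every commutative SQUARE / CHAIN of `G`-equivariant homomorphisms of
  `G`-monoids lifts verbatim to the Frobenioids — `frobenioidMap_square` (`e₂ ∘ I = γ ∘ e₁ ⇒ F(I) ⋙ F(e₂) = F(e₁) ⋙ F(γ)`:
  Cor 3.7 (i)'s first display, w4-d019's monoid-level `cor37_i_square` p446415) and `frobenioidMap_chain` (`Φ = e₃ ∘ e₁ ⇒
  F(Φ) = F(e₁) ⋙ F(e₃)`: `cor37_i_chain`, Def 3.8 (ii)'s chain of split Frobenioids), with the Gaussian-typed instance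
  `fgau_chain_eq` at abc-iut-L6-t7's `gaussianCovering`.
HONEST LIMITS: equalities of functors over the IDENTITY of `𝓑(G)⁰` (same acting group throughout — the identifications
`G_v(Π_{v▶})_t ≅ G_v(M^Θ_*▶(†F_v))_t ≅ G_v(M^Θ_*(†F_v))_t` being performed beforehand, as in w4-d019's typing of Cor 3.6 and as
Rmk 3.8.1 advises); the version over a CHANGE of base along `σ : G ⥲ G'` (`frobenioidMapOfPairIso`, p468022) composes only
up to a natural isomorphism of `CosetCat.pull`-composites, not constructed here; no side taken on [IUTchIII] Cor 3.12; typed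
≠ proved; nothing asserts abc proved or refuted.
-/

noncomputable section

namespace Literature.IUT.HodgeArakelov

open CategoryTheory Opposite Function
open Literature.AlgebraicGeometry.Frobenioids Literature.AnabelianGeometry.SemiGraphs

universe u v w u₁ v₁

/-! ### §1. Morphisms of a model Frobenioid up to `HEq` -/

/-- Bookkeeping for `Functor.hext`: morphisms of abc-iut-L1-t2's model Frobenioid with EQUAL endpoints are `HEq` as soon as
their four components `(deg_Fr, Base, Div, u)` are (`HEq` componentwise). [cite: MochizukiFrdI2008, Thm. 5.2(i) p.100] -/
theorem modelFrobenioid_hom_heq {D : Type u₁} [Category.{v₁} D] {Φ B : Dᵒᵖ ⥤ CommMonCat.{w}}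
    {DivB : B ⟶ monoidGp Φ} {X X' Y Y' : ModelFrobenioid Φ B DivB} (hX : X = X') (hY : Y = Y')
    (φ : X ⟶ Y) (φ' : X' ⟶ Y') (hd : ModelFrobenioid.degFr φ = ModelFrobenioid.degFr φ')
    (hb : HEq (ModelFrobenioid.baseMap φ) (ModelFrobenioid.baseMap φ'))
    (hdiv : HEq (ModelFrobenioid.div φ) (ModelFrobenioid.div φ'))
    (hu : HEq (ModelFrobenioid.unit φ) (ModelFrobenioid.unit φ')) : HEq φ φ' := by
  subst hX
  subst hY
  exact heq_of_eq (ModelFrobenioid.hom_ext hd (eq_of_heq hb) (eq_of_heq hdiv) (eq_of_heq hu))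

namespace CoveringMonoid

variable {G : Type u} [Group G] [TopologicalSpace G] {M M' M'' : CoveringMonoid.{u, v} G}

/-! ### §2. Functoriality of `frobenioidMap` -/

section Functoriality

variable (φ : M.O →* M'.O) (hφ : ∀ (g : G) (x : M.O), φ (M.act g x) = M'.act g (φ x))
  (ψ : M'.O →* M''.O) (hψ : ∀ (g : G) (x : M'.O), ψ (M'.act g x) = M''.act g (ψ x))

omit [TopologicalSpace G] in
include hφ hψ in
/-- The composite of equivariant homomorphisms is equivariant. [cite: Mochizuki2012, Def 3.8 (i) p.113] -/
theorem comp_equivariant : ∀ (g : G) (x : M.O), (ψ.comp φ) (M.act g x) = M''.act g ((ψ.comp φ) x) :=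
  fun g x => by rw [MonoidHom.comp_apply, MonoidHom.comp_apply, hφ, hψ]

omit [TopologicalSpace G] in
/-- The identity is equivariant. [cite: Mochizuki2012, Def 3.8 (i) p.113] -/
theorem id_equivariant : ∀ (g : G) (x : M.O), (MonoidHom.id M.O) (M.act g x) = M.act g ((MonoidHom.id M.O) x) :=
  fun _ _ => rfl

/-- `frobenioidMap` on objects: `(G/U, α) ↦ (G/U, η^gp α)`. [cite: MochizukiFrdI2008, Prop. 5.3 p.103] -/
theorem frobenioidMap_obj (X : M.frobenioid) :
    (frobenioidMap φ hφ).obj X = ⟨X.base, gpApp (divisorNatTrans φ hφ) (op X.base) X.cls⟩ := rfl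

/-- `Div` under `frobenioidMap`: classes go through `associatesMap` of the restriction to invariants.
[cite: MochizukiFrdI2008, Prop. 5.3 p.103] -/
theorem div_frobenioidMap_map {X Y : M.frobenioid} (f : X ⟶ Y) :
    ModelFrobenioid.div ((frobenioidMap φ hφ).map f) =
      associatesMap (invariantsHom φ hφ (X.base.sg : Subgroup G)) (ModelFrobenioid.div f) := rfl

/-- `u` under `frobenioidMap`: units go through the groupification of the restriction to invariants.
[cite: MochizukiFrdI2008, Prop. 5.3 p.103] -/
theorem unit_frobenioidMap_map {X Y : M.frobenioid} (f : X ⟶ Y) :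
    ModelFrobenioid.unit ((frobenioidMap φ hφ).map f) =
      MonGp.map (invariantsHom φ hφ (X.base.sg : Subgroup G)) (ModelFrobenioid.unit f) := rfl

omit [TopologicalSpace G] in
/-- Restriction to invariants respects composition. [cite: Mochizuki2012, Def 3.8 (i) p.113] -/
theorem invariantsHom_comp (hψφ : ∀ (g : G) (x : M.O), (ψ.comp φ) (M.act g x) = M''.act g ((ψ.comp φ) x))
    (U : Subgroup G) :
    invariantsHom (ψ.comp φ) hψφ U = (invariantsHom ψ hψ U).comp (invariantsHom φ hφ U) :=
  MonoidHom.ext fun _ => rfl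

omit [TopologicalSpace G] in
/-- Restriction of the identity to invariants is the identity. [cite: Mochizuki2012, Def 3.8 (i) p.113] -/
theorem invariantsHom_id (h : ∀ (g : G) (x : M.O), (MonoidHom.id M.O) (M.act g x) = M.act g ((MonoidHom.id M.O) x))
    (U : Subgroup G) : invariantsHom (MonoidHom.id M.O) h U = MonoidHom.id _ :=
  MonoidHom.ext fun _ => rfl

omit [TopologicalSpace G] in
/-- `associatesMap` respects composition (classes of classes). [cite: MochizukiFrdI2008, §0 p.11] -/
theorem associatesMap_comp {A B C : Type v} [CommMonoid A] [CommMonoid B] [CommMonoid C] (g : B →* C) (f : A →* B) :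
    associatesMap (g.comp f) = (associatesMap g).comp (associatesMap f) := by
  apply MonoidHom.ext
  intro x
  obtain ⟨a, rfl⟩ := Associates.mk_surjective x
  rw [MonoidHom.comp_apply, associatesMap_mk, associatesMap_mk, associatesMap_mk, MonoidHom.comp_apply]

omit [TopologicalSpace G] in
/-- `associatesMap` of the identity is the identity. [cite: MochizukiFrdI2008, §0 p.11] -/
theorem associatesMap_id {A : Type v} [CommMonoid A] : associatesMap (MonoidHom.id A) = MonoidHom.id _ := by
  apply MonoidHom.ext
  intro x
  obtain ⟨a, rfl⟩ := Associates.mk_surjective x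
  rw [associatesMap_mk]
  rfl

/-- The divisor-class components compose: `η_{ψφ}^gp = η_ψ^gp ∘ η_φ^gp` at every `G/U` (abc-iut-L1's `MonGp.map_comp`).
[cite: MochizukiFrdI2008, Prop. 5.3 p.103] -/
theorem gpApp_divisorNatTrans_comp (hψφ : ∀ (g : G) (x : M.O), (ψ.comp φ) (M.act g x) = M''.act g ((ψ.comp φ) x))
    (A : (CosetCat G)ᵒᵖ) (c : Algebra.GrothendieckGroup (M.divisorFunctor.obj A)) :
    gpApp (divisorNatTrans (ψ.comp φ) hψφ) A c =
      gpApp (divisorNatTrans ψ hψ) A (gpApp (divisorNatTrans φ hφ) A c) := by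
  change MonGp.map (associatesMap (invariantsHom (ψ.comp φ) hψφ ((unop A).sg : Subgroup G))) c =
    MonGp.map (associatesMap (invariantsHom ψ hψ ((unop A).sg : Subgroup G)))
      (MonGp.map (associatesMap (invariantsHom φ hφ ((unop A).sg : Subgroup G))) c)
  rw [invariantsHom_comp φ hφ ψ hψ hψφ, associatesMap_comp, MonGp.map_comp]
  rfl

/-- `η_{id}^gp = id`. [cite: MochizukiFrdI2008, Prop. 5.3 p.103] -/
theorem gpApp_divisorNatTrans_id (h : ∀ (g : G) (x : M.O), (MonoidHom.id M.O) (M.act g x) = M.act g ((MonoidHom.id M.O) x))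
    (A : (CosetCat G)ᵒᵖ) (c : Algebra.GrothendieckGroup (M.divisorFunctor.obj A)) :
    gpApp (divisorNatTrans (MonoidHom.id M.O) h) A c = c := by
  change MonGp.map (associatesMap (invariantsHom (MonoidHom.id M.O) h ((unop A).sg : Subgroup G))) c = c
  rw [invariantsHom_id, associatesMap_id, MonGp.map_id]
  rfl

/-- **`frobenioidMap` depends only on the underlying homomorphism** (the equivariance proof is irrelevant; equal maps
give equal functors). [cite: MochizukiFrdI2008, Prop. 5.3 p.103] -/
theorem frobenioidMap_congr {φ φ' : M.O →* M'.O} (hφ : ∀ (g : G) (x : M.O), φ (M.act g x) = M'.act g (φ x))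
    (hφ' : ∀ (g : G) (x : M.O), φ' (M.act g x) = M'.act g (φ' x)) (h : φ = φ') :
    frobenioidMap φ hφ = frobenioidMap φ' hφ' := by
  subst h
  rfl

/-- **`F(id) = 𝟭`**: the functor of model Frobenioids of the identity of a `G`-monoid is the identity functor.
[cite: MochizukiFrdI2008, Prop. 5.3 p.103] -/
theorem frobenioidMap_id (h : ∀ (g : G) (x : M.O), (MonoidHom.id M.O) (M.act g x) = M.act g ((MonoidHom.id M.O) x)) :
    frobenioidMap (MonoidHom.id M.O) h = 𝟭 M.frobenioid := by
  have hobj : ∀ X : M.frobenioid, (frobenioidMap (MonoidHom.id M.O) h).obj X = X := fun X => by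
    rw [frobenioidMap_obj, gpApp_divisorNatTrans_id]
  refine Functor.hext hobj fun X Y f => ?_
  refine modelFrobenioid_hom_heq (hobj X) (hobj Y) _ _ rfl (heq_of_eq rfl) (heq_of_eq ?_) (heq_of_eq ?_)
  · rw [div_frobenioidMap_map, invariantsHom_id, associatesMap_id]
    rfl
  · rw [unit_frobenioidMap_map, invariantsHom_id, MonGp.map_id]
    rfl

/-- **`F(φ) ⋙ F(ψ) = F(ψ ∘ φ)` — functoriality of Def 3.8's «isomorphisms of monoids … interpreted as isomorphisms of
Frobenioids» in composites** ([FrdI] Prop 5.3's natural functors compose): on objects `(G/U, η_ψ^gp(η_φ^gp α)) =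
(G/U, η_{ψφ}^gp α)`, on morphisms `(d, f, η_ψ(η_φ Div), β_ψ(β_φ u)) = (d, f, η_{ψφ} Div, β_{ψφ} u)`.
[cite: Mochizuki2012, Def 3.8 (ii) p.114] -/
theorem frobenioidMap_comp :
    frobenioidMap φ hφ ⋙ frobenioidMap ψ hψ = frobenioidMap (ψ.comp φ) (comp_equivariant φ hφ ψ hψ) := by
  have hobj : ∀ X : M.frobenioid, (frobenioidMap φ hφ ⋙ frobenioidMap ψ hψ).obj X =
      (frobenioidMap (ψ.comp φ) (comp_equivariant φ hφ ψ hψ)).obj X := fun X => by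
    change (frobenioidMap ψ hψ).obj ((frobenioidMap φ hφ).obj X) = _
    rw [frobenioidMap_obj, frobenioidMap_obj, frobenioidMap_obj, gpApp_divisorNatTrans_comp φ hφ ψ hψ]
  refine Functor.hext hobj fun X Y f => ?_
  refine modelFrobenioid_hom_heq (hobj X) (hobj Y) _ _ rfl (heq_of_eq rfl) (heq_of_eq ?_) (heq_of_eq ?_)
  · change associatesMap (invariantsHom ψ hψ (X.base.sg : Subgroup G))
        (associatesMap (invariantsHom φ hφ (X.base.sg : Subgroup G)) (ModelFrobenioid.div f)) =
      associatesMap (invariantsHom (ψ.comp φ) (comp_equivariant φ hφ ψ hψ) (X.base.sg : Subgroup G))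
        (ModelFrobenioid.div f)
    rw [invariantsHom_comp φ hφ ψ hψ, associatesMap_comp, MonoidHom.comp_apply]
  · change MonGp.map (invariantsHom ψ hψ (X.base.sg : Subgroup G))
        (MonGp.map (invariantsHom φ hφ (X.base.sg : Subgroup G)) (ModelFrobenioid.unit f)) =
      MonGp.map (invariantsHom (ψ.comp φ) (comp_equivariant φ hφ ψ hψ) (X.base.sg : Subgroup G))
        (ModelFrobenioid.unit f)
    rw [invariantsHom_comp φ hφ ψ hψ, MonGp.map_comp, MonoidHom.comp_apply]

end Functoriality

/-! ### §3. Cor 3.7 (i) / Def 3.8 (ii): commutative squares and chains of equivariant maps lift to the Frobenioids -/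

section Squares

variable {M₁ M₂ M₃ M₄ : CoveringMonoid.{u, v} G}

/-- **Cor 3.7 (i) «compatible [in the evident sense] collections of isomorphisms» at the Frobenioid level, SQUARES**: if
`G`-equivariant homomorphisms satisfy `e₂ ∘ I = γ ∘ e₁` on elements (the monoid-level square of the first display —
w4-d019's `cor37_i_square`: `I` = functoriality in the mono-theta environment, `e₁`, `e₂` = the restriction isomorphisms
`Ψ^ι_env ⥲ Ψ_ξ`, `γ` = the middle isomorphism), then the square of functors of model Frobenioids commutes ON THE NOSE:
`F(I) ⋙ F(e₂) = F(e₁) ⋙ F(γ)`. [cite: Mochizuki2012, Cor 3.7 (i) p.111] -/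
theorem frobenioidMap_square (I : M₁.O →* M₂.O) (hI : ∀ (g : G) (x : M₁.O), I (M₁.act g x) = M₂.act g (I x))
    (e₂ : M₂.O →* M₄.O) (he₂ : ∀ (g : G) (x : M₂.O), e₂ (M₂.act g x) = M₄.act g (e₂ x))
    (e₁ : M₁.O →* M₃.O) (he₁ : ∀ (g : G) (x : M₁.O), e₁ (M₁.act g x) = M₃.act g (e₁ x))
    (γ : M₃.O →* M₄.O) (hγ : ∀ (g : G) (x : M₃.O), γ (M₃.act g x) = M₄.act g (γ x))
    (hsq : ∀ x : M₁.O, e₂ (I x) = γ (e₁ x)) :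
    frobenioidMap I hI ⋙ frobenioidMap e₂ he₂ = frobenioidMap e₁ he₁ ⋙ frobenioidMap γ hγ := by
  rw [frobenioidMap_comp I hI e₂ he₂, frobenioidMap_comp e₁ he₁ γ hγ]
  exact frobenioidMap_congr _ _ (MonoidHom.ext hsq)

/-- **Def 3.8 (ii) «`F_{†F^Θ_v,α} ⥲ F^ι_env(M^Θ_*) ⥲ F_ξ(M^Θ_*) ⥲ F_{F_ξ}(†F_v)` … compatible» / Cor 3.7 (i) lower right-hand portion,
CHAINS**: if the end-to-end homomorphism is the composite on elements, `Φ = e₃ ∘ e₁` (w4-d019's `cor37_i_chain`: restriction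
followed by the Cor 3.6 (ii) transport), then `F(Φ) = F(e₁) ⋙ F(e₃)`. [cite: Mochizuki2012, Def 3.8 (ii) p.114] -/
theorem frobenioidMap_chain (e₁ : M₁.O →* M₂.O) (he₁ : ∀ (g : G) (x : M₁.O), e₁ (M₁.act g x) = M₂.act g (e₁ x))
    (e₃ : M₂.O →* M₃.O) (he₃ : ∀ (g : G) (x : M₂.O), e₃ (M₂.act g x) = M₃.act g (e₃ x))
    (Φ : M₁.O →* M₃.O) (hΦ : ∀ (g : G) (x : M₁.O), Φ (M₁.act g x) = M₃.act g (Φ x))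
    (hchain : ∀ x : M₁.O, Φ x = e₃ (e₁ x)) :
    frobenioidMap Φ hΦ = frobenioidMap e₁ he₁ ⋙ frobenioidMap e₃ he₃ := by
  rw [frobenioidMap_comp e₁ he₁ e₃ he₃]
  exact frobenioidMap_congr _ _ (MonoidHom.ext hchain)

/-- A THREE-step chain (the full bottom line of Cor 3.6 (ii) / Def 3.8 (ii): `Ψ_{†F^Θ_v,α} ⥲ Ψ^ι_env ⥲ Ψ_ξ ⥲ Ψ_{F_ξ}`):
`F(e₃ ∘ e₂ ∘ e₁) = F(e₁) ⋙ F(e₂) ⋙ F(e₃)`. [cite: Mochizuki2012, Def 3.8 (ii) p.114] -/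
theorem frobenioidMap_chain₃ (e₁ : M₁.O →* M₂.O) (he₁ : ∀ (g : G) (x : M₁.O), e₁ (M₁.act g x) = M₂.act g (e₁ x))
    (e₂ : M₂.O →* M₃.O) (he₂ : ∀ (g : G) (x : M₂.O), e₂ (M₂.act g x) = M₃.act g (e₂ x))
    (e₃ : M₃.O →* M₄.O) (he₃ : ∀ (g : G) (x : M₃.O), e₃ (M₃.act g x) = M₄.act g (e₃ x))
    (Φ : M₁.O →* M₄.O) (hΦ : ∀ (g : G) (x : M₁.O), Φ (M₁.act g x) = M₄.act g (Φ x))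
    (hchain : ∀ x : M₁.O, Φ x = e₃ (e₂ (e₁ x))) :
    frobenioidMap Φ hΦ = frobenioidMap e₁ he₁ ⋙ frobenioidMap e₂ he₂ ⋙ frobenioidMap e₃ he₃ := by
  rw [frobenioidMap_comp e₂ he₂ e₃ he₃, frobenioidMap_comp e₁ he₁]
  exact frobenioidMap_congr _ _ (MonoidHom.ext hchain)

end Squares

end CoveringMonoid

/-! ### §4. The Gaussian-typed instance: `F^ι_env ⥲ F_ξ ⥲ F_{Im ξ}` for a theta monoid acting through a section -/

namespace BadPrimeGaussianMonoids

open TemperedThetaMonoids CoveringMonoid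

variable {G : Type u} [Group G] [TopologicalSpace G] {T : Type w} {M : Type v} [CommMonoid M] {N : Type v} [CommMonoid N]
  (β : G →* MulAut M) (γ : G →* MulAut N)

/-- **Def 3.8 (ii) «`F^ι_env(M^Θ_*) ⥲ F_ξ(M^Θ_*) ⥲ F_{F_ξ}(†F_v)`» in the Gaussian typing (same acting group `G`):** for a `G`-monoid
`M₁` (print: `G_v(M^Θ_*▶) ↷ Ψ^ι_env`, the action through the section `s_{t₀}`), a `G`-equivariant restriction `e₁ : M₁ → Ψ_ξ`
(w5-d086's `restrictionIso'_equivariant` shape), and the labelled Kummer transport `e⁻¹ : Ψ_ξ ⥲ Ψ_{Im ξ}` (`gaussianMonoidIso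
e⁻¹ ξ`, equivariant for `σ = id`), the functor of the end-to-end restriction-then-transport IS the composite of the functors
`F(M₁) ⥤ Fgau β ξ hS ⥤ FFgau γ e ξ hS'`. [cite: Mochizuki2012, Def 3.8 (ii) p.114] -/
theorem fgau_chain_eq {M₁ : CoveringMonoid.{u, max w v} G} {ξ : T → M}
    (hS : ∀ (g : G) (y : T → M), y ∈ gaussianMonoid ξ → piIso T (β g) y ∈ gaussianMonoid ξ) (e : N ≃* M)
    (he : ∀ (g : G) (y : M), e.symm (β g y) = γ g (e.symm y))
    (hS' : ∀ (g : G) (y' : T → N), y' ∈ gaussianMonoid (fun t => e.symm (ξ t)) →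
      piIso T (γ g) y' ∈ gaussianMonoid (fun t => e.symm (ξ t)))
    (e₁ : M₁.O →* (gaussianCovering β ξ hS).O)
    (he₁ : ∀ (g : G) (x : M₁.O), e₁ (M₁.act g x) = (gaussianCovering β ξ hS).act g (e₁ x)) :
    frobenioidMap (M' := gaussianCovering γ (fun t => e.symm (ξ t)) hS')
        (((gaussianMonoidIso e.symm ξ : _ ≃* _) : _ →* _).comp e₁)
        (comp_equivariant (M'' := gaussianCovering γ (fun t => e.symm (ξ t)) hS') e₁ he₁ _
          (gaussianMonoidIso_act β γ (σ := id) e.symm he hS hS')) =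
      frobenioidMap e₁ he₁ ⋙
        frobenioidMap (M := gaussianCovering β ξ hS) (M' := gaussianCovering γ (fun t => e.symm (ξ t)) hS')
          ((gaussianMonoidIso e.symm ξ : _ ≃* _) : _ →* _) (gaussianMonoidIso_act β γ (σ := id) e.symm he hS hS') :=
  (frobenioidMap_comp e₁ he₁ _ _).symm

end BadPrimeGaussianMonoids

end Literature.IUT.HodgeArakelov

end
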